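import Literature.NumberTheory.ConnesConsani.FrobeniusCompositionGerms
import HarnessLib

/-!
# Connes–Consani, *Geometry of the arithmetic site* (2016), §7.4: Lemma 7.8 (the reduction of
# `𝔹_ε ⊗_{ℤ_min⁺} ℛ(α)` is `ℛ_ε(α,α)`), the composition `Id_ε ∘ Ψ(α)`, and the third sentence
# of Theorem 7.7 (= Thm. 1.2 = CRAS 2014 Thm. 4.1): `Ψ(λ) ∘ Ψ(λ') = Id_ε ∘ Ψ(λλ')` — PROVED

Topic `Literature/NumberTheory/ConnesConsani`. Source: A. Connes, C. Consani, *Geometry of the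
arithmetic site*, Adv. Math. 291 (2016) 274–329 = arXiv:1502.05580 [bib
`ConnesConsani2016ArithmeticSite`], §7.4 "The composition `Ψ(λ) ∘ Ψ(λ')`", pp. 28–29 of the arXiv
version (Lemma 7.8 and the last paragraph of the proof of Thm. 7.7); announced in C. R. Math. 352
(2014) 971–975 [bib `ConnesConsani2014ArithmeticSite`] Thm. 4.1. Continues
`FrobeniusComposition.lean` (Def. 7.1, `Ψ(λ)`, the §7.2 composition recipe
`IsTensorReduction`/`IsComposition`, Prop. 7.3, Thm. 7.7 sentences 1–2) and
`FrobeniusCompositionGerms.lean` (`𝒢`, `𝔹_ε`, `Id_ε` = Def. 7.6, `ℛ_ε(λλ',λ')`, Lemma 7.5, Prop. 7.4,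
the correspondence (70) `germComp`, `Ψ(λ) ∘ Ψ(λ') = (70)` for `λ ∉ ℚ`).

## The statements, verbatim (Adv. Math. numbering)

* (Proof of Thm. 7.7, p. 28) "Assume now that `α = λλ' ∈ ℚ`. Then the sub-semiring `R` of
  `ℛ_ε(λλ',λ')` generated by the `ℓ(q^n)` and `r(q^m)` is formed of finite sums of the form
  `σ(ε) = ∑ q^{(1+ε)αn_j + m_j}` […]. Let us compare this with the compositions `Id_ε ∘ Ψ(α)` and
  `Ψ(α) ∘ Id_ε`. We first need to determine the reduction of `𝔹_ε ⊗_{ℤ_min⁺} ℛ(α)`."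
* **Lemma 7.8.** "Let `α ∈ ℚ₊*`. (i) Let `ψ : 𝔹_ε × ℛ(α) → 𝒢` be given by
  `ψ(q^{(1+ε)i+j}, b) := q^{(1+ε)αi} q^{αj} b`, `∀ i, j ∈ ℕ`, `b ∈ ℛ(α)`. Then `ψ` is bilinear,
  `ψ(aa',bb') = ψ(a,b)ψ(a',b')`, `∀ a, a' ∈ 𝔹_ε`, `b, b' ∈ ℛ(α)` and
  `ψ(r_ε(x)a, b) = ψ(a, ℓ(α)(x)b)`, `∀ a ∈ 𝔹_ε`, `b ∈ ℛ(α)`, `x ∈ ℤ_min⁺` (72). (ii) Let `R` be a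
  semiring and `φ : 𝔹_ε × ℛ(α) → R` be a bilinear map such that `φ(aa',bb') = φ(a,b)φ(a',b')`,
  `∀ a, a' ∈ 𝔹_ε`, `b, b' ∈ ℛ(α)` and `φ(r_ε(x)a, b) = φ(a, ℓ(α)(x)b)`, `∀ a ∈ 𝔹_ε`, `b ∈ ℛ(α)`,
  `x ∈ ℤ_min⁺` (73). Then there exists a unique homomorphism `ρ : ℛ_ε(α,α) → R` such that
  `φ = ρ ∘ ψ`." Proof of (i): "One has `ψ(a,b) = Fr_α(a)b` which gives the required properties."
  Proof of (ii): "Let `U := φ(q^{(1+ε)},1)`, `V := φ(q,1) = φ(1,q^α)`, `W := φ(1,q)`. Let us show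
  that: `a,b,c,a',b',c' ∈ ℕ & αa + αb + c < αa' + αb' + c' ⟹ U^aV^bW^c + U^{a'}V^{b'}W^{c'} =
  U^aV^bW^c` […] (74) […] Since […] the map `R ∋ x ↦ xⁿ ∈ R` is an injective endomorphism […]
  (75). We can find `n ∈ ℕ` and `k, k' ∈ ℕ` such that `a₁ < k/n`, `k'/n < a₂`,
  `αk/n + β₁ < αk'/n + β₂`. One then has, using `na₁ < k`, that in `𝔹_ε`,
  `q^{(1+ε)na₁} + q^k = q^{(1+ε)na₁}` […]. Using (72) one has `φ(q^k, q^{nβ₁}) = φ(1, q^{nβ₁+αk})`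
  […]. Moreover, using `k' < na₂` one has `q^{(1+ε)na₂} + q^{k'} = q^{k'}` in `𝔹_ε` […]. The products
  `V_ε^bW_ε^c` and `V^bW^c` only depend on `β = αb + c`. […] There is a largest `t ∈ ℕ` such that
  `u − tα ∈ αℕ + ℕ` and one then has `F(u) = {(a, u − aα) ∣ 0 ≤ a ≤ t}` […]
  `∑_S Z_ε^j = ∑_{S'} Z_ε^j ⟺ inf(S) = inf(S') & max(S) = max(S')`. Thus the proof of (ii) follows
  from Lemma 7.5."
* (End of the proof of Thm. 7.7, p. 29) "In order to obtain the composition `Id_ε ∘ Ψ(λλ')` one then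
  takes the left and right actions of `ℤ_min⁺` in the sub-semiring of `𝒢` generated by the range of
  `ψ` generated by the `q^{(1+ε)αi + αj + k}` for `i, j, k ∈ ℕ`. One gets the sub-semiring of `𝒢`
  generated by the `q^{(1+ε)αi + k}` for `i, k ∈ ℕ`, with left action of `q` given by `i ↦ i+1` and
  right action by `k ↦ k+1`. This coincides with (70) and thus shows that
  `Ψ(λ) ∘ Ψ(λ') = Id_ε ∘ Ψ(λλ')` where `Id_ε` is the tangential deformation of the identity
  correspondence." **Theorem 7.7, third sentence.** "When `λ, λ'` are irrational and `λλ' ∈ ℚ`,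
  `Ψ(λ) ∘ Ψ(λ') = Id_ε ∘ Ψ(λλ')` where `Id_ε` is the tangential deformation of the identity
  correspondence."

## Rendering (continuing the two companion files)

* `Fr_α` on `𝒢` is `GermExp.frobG α` (the exponent germ scaled by `α`; a semiring endomorphism
  for `α ≥ 0`), so that "`ψ(a,b) = Fr_α(a) b`" is LITERALLY the definition of `idPsi α`
  (`= frobG α a * gconst b`). `ℛ_ε(α,α)` is `epsSemiringId α := epsSemiring 1 α`, i.e. the
  `ℛ_ε(λλ',λ')` of §7.3 with `(λ,λ') = (1,α)`; `epsSemiringId_eq_closure`: it is the sub-semiring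
  of `𝒢` generated by `q, q^α, q^{(1+ε)α}` verbatim. The monomials `q^{(1+ε)i+j}` of `𝔹_ε` are
  `bmono i j`; every element of `𝔹_ε` is `0` or a finite sum of them (`exists_bSum`).
* Proof of (ii): the printed addition rule (74) is `ConnesConsani2016_lemma_7_8_addRule`, proved
  as printed (`n`-th powers (75), `exists_nat_approx₈` for `n, k, k'`, the two absorptions in
  `𝔹_ε` — which need the STRICT inequalities `na₁ < k`, `k' < na₂` because germs at `ε = 0` are
  two-sided; for `a₂ = 0` one takes `k' = 0` — and (72)). The `F(u)`/Lemma 7.5 step is routed,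
  exactly as for Prop. 7.4 in `FrobeniusCompositionGerms.lean`, through the generic skeleton
  `MonoRules`/`rhoGHom` of that file with `(λ,λ') = (1,α)`: monomials `U^aW^β` (`rMono₈`), the
  middle absorption `rMono₈_mid` from `U^aW^β`-convexity (`add_eq_of_pow_eq_mul_pow`, the
  multiplicative content of Lemma 7.5) instead of the semifields of fractions `Frac(R)`. As for
  Prop. 7.4, rationality of `α` is not used: Lemma 7.8 holds for every real `α > 0`
  (`ConnesConsani2016_lemma_7_8`; the printed hypothesis is recorded in `…_rat`).
* What is PROVED here: **Lemma 7.8 (i)** `ConnesConsani2016_lemma_7_8_i`; **(74)**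
  `ConnesConsani2016_lemma_7_8_addRule`; **Lemma 7.8 (ii)** `ConnesConsani2016_lemma_7_8_ii`
  (existence `rho78Hom`, `rho78Hom_idPsi`; uniqueness `existsUnique_rho78`); **Lemma 7.8 packaged**
  `ConnesConsani2016_lemma_7_8 : IsTensorReduction Id_ε Ψ(α) ℛ_ε(α,α) ψ`; **"`Id_ε ∘ Ψ(α)` is the
  correspondence (70)"** `ConnesConsani2016_thm_7_7_idEps_comp` (every `α > 0`); compositions of
  reduced correspondences are unique up to isomorphism (`CompositionDatum.iso`,
  `IsComposition.iso` — the "canonical isomorphism" of §7.2, from the universal property); and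
  **Theorem 7.7, third sentence** `ConnesConsani2016_thm_7_7_third` (`Ψ(λ) ∘ Ψ(λ')` and
  `Id_ε ∘ Ψ(λλ')` are both (70)) and `ConnesConsani2016_thm_7_7_third_iff` (a reduced correspondence
  is `Ψ(λ) ∘ Ψ(λ')` iff it is `Id_ε ∘ Ψ(λλ')`). With the two companion files, **all three sentences
  of Thm. 7.7 = Thm. 1.2 are Lean theorems.**
* NOT typed: the composition `Ψ(α) ∘ Id_ε` (mentioned, not computed, in the text); Lemma 7.2.
-/

noncomputable section

open Set Tropical Filter Topology

namespace Literature.NumberTheory.ConnesConsani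

local notation "𝕋" => RMaxExp
local notation "ℕ̄" => ZMinPlus

/-! ## The Frobenius endomorphisms `Fr_u` of `𝒢`: `q^{f(ε)} ↦ q^{u f(ε)}` -/

namespace GermExp

/-- Scaling an exponent germ: `f(ε) ↦ u f(ε)` (the exponent of `Fr_u(q^{f(ε)}) = q^{u f(ε)}`).
[cite: ConnesConsani2016ArithmeticSite, Lemma 7.8 (i) ("`ψ(a,b) = Fr_α(a) b`")] -/
def escale (u : ℝ) (g : EGerm) : EGerm := Germ.map (fun x : ℝ => u * x) g

/-- `escale` on a representative. [cite: ConnesConsani2016ArithmeticSite, Lemma 7.8 (i)] -/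
theorem escale_coe (u : ℝ) (f : ℝ → ℝ) :
    escale u (f : EGerm) = ((fun ε => u * f ε : ℝ → ℝ) : EGerm) := rfl

/-- `u (g + h) = u g + u h` on germs. [cite: ConnesConsani2016ArithmeticSite, Lemma 7.8 (i)] -/
theorem escale_add (u : ℝ) (g h : EGerm) : escale u (g + h) = escale u g + escale u h := by
  refine g.inductionOn₂ h fun f f' => ?_
  rw [← Germ.coe_add, escale_coe, escale_coe, escale_coe, ← Germ.coe_add]
  congr 1
  funext ε
  simp [mul_add]

/-- `u (g ⊓ h) = u g ⊓ u h` on germs for `u ≥ 0`. [cite: ConnesConsani2016ArithmeticSite, Lemma 7.8 (i)] -/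
theorem escale_inf {u : ℝ} (hu : 0 ≤ u) (g h : EGerm) : escale u (g ⊓ h) = escale u g ⊓ escale u h := by
  refine g.inductionOn₂ h fun f f' => ?_
  show escale u (((fun ε => f ε ⊓ f' ε : ℝ → ℝ)) : EGerm) =
    (((fun ε => u * f ε ⊓ u * f' ε : ℝ → ℝ)) : EGerm)
  rw [escale_coe]
  congr 1
  funext ε
  exact mul_min_of_nonneg _ _ hu

/-- `u · 0 = 0` on germs. [cite: ConnesConsani2016ArithmeticSite, Lemma 7.8 (i)] -/
theorem escale_zero (u : ℝ) : escale u (0 : EGerm) = 0 := by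
  rw [← Germ.coe_zero, escale_coe]
  congr 1
  funext ε
  simp

/-- The map underlying `Fr_u` on `𝒢`. [cite: ConnesConsani2016ArithmeticSite, Lemma 7.8 (i)] -/
def frobGFun (u : ℝ) (x : GermExp) : GermExp := ⟨x.val.map (escale u)⟩

/-- `Fr_u(0) = 0`. [cite: ConnesConsani2016ArithmeticSite, Lemma 7.8 (i)] -/
@[simp] theorem frobGFun_zero (u : ℝ) : frobGFun u 0 = 0 := rfl

/-- `Fr_u(q^g) = q^{ug}`. [cite: ConnesConsani2016ArithmeticSite, Lemma 7.8 (i)] -/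
@[simp] theorem frobGFun_gexp (u : ℝ) (g : EGerm) : frobGFun u (gexp g) = gexp (escale u g) := rfl

/-- **The Frobenius `Fr_u` of `𝒢`** (`u ≥ 0`), `q^{f(ε)} ↦ q^{u f(ε)}`, a semiring endomorphism
(pointwise the automorphism `Fr_u ∈ Aut(ℝ₊^max)` of the values). [cite: ConnesConsani2016ArithmeticSite, Lemma 7.8 (i) ("`ψ(a,b) = Fr_α(a) b`")] -/
def frobG (u : ℝ) (hu : 0 ≤ u) : GermExp →+* GermExp where
  toFun := frobGFun u
  map_zero' := rfl
  map_one' := by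
    rw [show (1 : GermExp) = gexp 0 from rfl, frobGFun_gexp, escale_zero]
  map_mul' x y := by
    rcases eq_zero_or_eq_gexp x with rfl | ⟨g, rfl⟩ <;>
      rcases eq_zero_or_eq_gexp y with rfl | ⟨h, rfl⟩
    · simp
    · simp
    · simp
    · rw [gexp_mul, frobGFun_gexp, frobGFun_gexp, frobGFun_gexp, gexp_mul, escale_add]
  map_add' x y := by
    rcases eq_zero_or_eq_gexp x with rfl | ⟨g, rfl⟩ <;>
      rcases eq_zero_or_eq_gexp y with rfl | ⟨h, rfl⟩
    · simp
    · simp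
    · simp
    · rw [gexp_add, frobGFun_gexp, frobGFun_gexp, frobGFun_gexp, gexp_add, escale_inf hu]

/-- `Fr_u(q^{v+sε}) = q^{uv + usε}`. [cite: ConnesConsani2016ArithmeticSite, Lemma 7.8 (i)] -/
@[simp] theorem frobG_gaff (u : ℝ) (hu : 0 ≤ u) (v s : ℝ) : frobG u hu (gaff v s) = gaff (u * v) (u * s) := by
  show frobGFun u (gexp (affG v s)) = gexp (affG (u * v) (u * s))
  rw [frobGFun_gexp]
  unfold affG
  rw [escale_coe]
  congr 2
  funext ε
  ring

end GermExp

open GermExp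

/-! ## `ℛ_ε(α,α)`, the monomials `q^{(1+ε)i+j}` of `𝔹_ε`, and the map `ψ` of Lemma 7.8 (i) -/

/-- **`ℛ_ε(α,α)`**: the sub-semiring of `𝒢` generated by `q`, `q^α` and `q^{(1+ε)α}` — the
semiring `ℛ_ε(λλ',λ')` of §7.3 with `(λ, λ') = (1, α)`. [cite: ConnesConsani2016ArithmeticSite, Lemma 7.8 (ii) (`ρ : ℛ_ε(α,α) → R`) and §7.3] -/
abbrev epsSemiringId (α : ℝ) : Subsemiring GermExp := epsSemiring 1 α

/-- `ℛ_ε(α,α)` is generated by `q`, `q^α`, `q^{(1+ε)α}` verbatim. [cite: ConnesConsani2016ArithmeticSite, §7.3 and Lemma 7.8] -/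
theorem epsSemiringId_eq_closure (α : ℝ) :
    epsSemiringId α = Subsemiring.closure {gaff 1 0, gaff α 0, gaff α α} := by
  show Subsemiring.closure _ = _
  rw [one_mul]

/-- `q ∈ ℛ_ε(α,α)`. [cite: ConnesConsani2016ArithmeticSite, §7.3] -/
theorem q_mem_epsSemiringId (α : ℝ) : gaff 1 0 ∈ epsSemiringId α :=
  Subsemiring.subset_closure (by simp)

/-- `q^α ∈ ℛ_ε(α,α)`. [cite: ConnesConsani2016ArithmeticSite, §7.3] -/
theorem qα_mem_epsSemiringId (α : ℝ) : gaff α 0 ∈ epsSemiringId α :=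
  Subsemiring.subset_closure (by simp)

/-- `q^{(1+ε)α} ∈ ℛ_ε(α,α)`. [cite: ConnesConsani2016ArithmeticSite, §7.3] -/
theorem qαε_mem_epsSemiringId (α : ℝ) : gaff α α ∈ epsSemiringId α := by
  have h : gaff (1 * α) (1 * α) ∈ epsSemiringId α := Subsemiring.subset_closure (by simp)
  rwa [one_mul] at h

/-- `q^{(1+ε)i + j} ∈ 𝔹_ε`. [cite: ConnesConsani2016ArithmeticSite, §7.4 (`𝔹_ε` generated by `q`, `q^{1+ε}`)] -/
theorem gaff_mem_Beps (i j : ℕ) : gaff ((i : ℝ) + j) i ∈ Beps := by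
  have h : gaff ((i : ℝ) + j) i = gaff 1 1 ^ i * gaff 1 0 ^ j := by
    rw [gaff_pow, gaff_pow, gaff_mul]; congr 1 <;> ring
  rw [h]
  exact mul_mem (pow_mem qeps_mem_Beps i) (pow_mem q_mem_Beps j)

/-- **The monomial `q^{(1+ε)i + j} = (q^{1+ε})^i q^j` of `𝔹_ε`.**
[cite: ConnesConsani2016ArithmeticSite, Lemma 7.8 (i) (`ψ(q^{(1+ε)i+j}, b)`)] -/
def bmono (i j : ℕ) : Beps := ⟨gaff ((i : ℝ) + j) i, gaff_mem_Beps i j⟩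

/-- The monomial in `𝒢`. [cite: ConnesConsani2016ArithmeticSite, Lemma 7.8 (i)] -/
@[simp] theorem coe_bmono (i j : ℕ) : (bmono i j : GermExp) = gaff ((i : ℝ) + j) i := rfl

/-- `q^{(1+ε)0+0} = 1`. [cite: ConnesConsani2016ArithmeticSite, Lemma 7.8 (proof of (ii))] -/
theorem bmono_zero : bmono 0 0 = 1 := Subtype.ext (by simp)

/-- Monomials multiply by adding exponents. [cite: ConnesConsani2016ArithmeticSite, Lemma 7.8 (proof of (ii): multiplicativity)] -/
theorem bmono_mul (i j i' j' : ℕ) : bmono i j * bmono i' j' = bmono (i + i') (j + j') :=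
  Subtype.ext (by simp only [Subsemiring.coe_mul, coe_bmono, gaff_mul, Nat.cast_add]; congr 1; ring)

/-- Powers of monomials. [cite: ConnesConsani2016ArithmeticSite, Lemma 7.8 (proof of (ii): `n`-th powers)] -/
theorem bmono_pow (i j n : ℕ) : bmono i j ^ n = bmono (n * i) (n * j) := by
  induction n with
  | zero => rw [pow_zero, Nat.zero_mul, Nat.zero_mul, bmono_zero]
  | succ n ih => rw [pow_succ, ih, bmono_mul]; congr 1 <;> ring

/-- `r_ε(q^k) = q^k = q^{(1+ε)0 + k}`. [cite: ConnesConsani2016ArithmeticSite, Def. 7.6] -/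
theorem epsR_nexp (k : ℕ) : epsR (nexp k) = bmono 0 k := Subtype.ext (by simp)

/-- `ℓ_ε(q^k) = q^{(1+ε)k}`. [cite: ConnesConsani2016ArithmeticSite, Def. 7.6] -/
theorem epsEll_nexp (k : ℕ) : epsEll (nexp k) = bmono k 0 := Subtype.ext (by simp)

/-- `q^{(1+ε)i + (j+k)} = r_ε(q^k) q^{(1+ε)i + j}`. [cite: ConnesConsani2016ArithmeticSite, Lemma 7.8 (proof of (ii), eq. (72))] -/
theorem bmono_add_right (i j k : ℕ) : bmono i (j + k) = epsR (nexp k) * bmono i j := by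
  rw [epsR_nexp, bmono_mul, Nat.zero_add, add_comm]

/-- Absorption in `𝔹_ε`: for `i + j < i' + j'`, `q^{(1+ε)i+j} + q^{(1+ε)i'+j'} = q^{(1+ε)i+j}` ("using
`na₁ < k`, that in `𝔹_ε`, `q^{(1+ε)na₁} + q^k = q^{(1+ε)na₁}`").
[cite: ConnesConsani2016ArithmeticSite, Lemma 7.8 (proof of (ii))] -/
theorem bmono_add_of_lt {i j i' j' : ℕ} (h : i + j < i' + j') : bmono i j + bmono i' j' = bmono i j :=
  Subtype.ext (by
    simp only [Subsemiring.coe_add, coe_bmono]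
    exact gaff_add_of_lt (by exact_mod_cast h) _ _)

/-- `𝔹_ε` has characteristic one. [cite: ConnesConsani2016ArithmeticSite, §7.4] -/
theorem one_add_one_Beps : (1 : Beps) + 1 = 1 := Subtype.ext GermExp.one_add_one

/-- **Every element of `𝔹_ε` is `0` or a finite sum of monomials `q^{(1+ε)i + j}`.**
[cite: ConnesConsani2016ArithmeticSite, §7.4 (`𝔹_ε` "generated […] by `q` and `θ_{1+ε}(q) = q^{1+ε}`")] -/
theorem exists_bSum {x : GermExp} (hx : x ∈ Beps) :
    x = 0 ∨ ∃ S : Finset (ℕ × ℕ), S.Nonempty ∧ x = ∑ p ∈ S, (bmono p.1 p.2 : GermExp) := by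
  classical
  induction hx using Subsemiring.closure_induction with
  | mem g hg =>
    simp only [Set.mem_insert_iff, Set.mem_singleton_iff] at hg
    right
    rcases hg with rfl | rfl
    · exact ⟨{((0 : ℕ), (1 : ℕ))}, by simp, by simp⟩
    · exact ⟨{((1 : ℕ), (0 : ℕ))}, by simp, by simp⟩
  | zero => exact Or.inl rfl
  | one => exact Or.inr ⟨{((0 : ℕ), (0 : ℕ))}, by simp, by simp⟩
  | add x y _ _ ihx ihy =>
    rcases ihx with rfl | ⟨S, hS, rfl⟩
    · rw [zero_add]; exact ihy
    rcases ihy with rfl | ⟨S', hS', rfl⟩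
    · rw [add_zero]; exact Or.inr ⟨S, hS, rfl⟩
    refine Or.inr ⟨S ∪ S', hS.mono Finset.subset_union_left, ?_⟩
    rw [Finset.sum_union_idem (fun x => add_self_of_one_add_one GermExp.one_add_one x)]
  | mul x y _ _ ihx ihy =>
    rcases ihx with rfl | ⟨S, hS, rfl⟩
    · rw [zero_mul]; exact Or.inl rfl
    rcases ihy with rfl | ⟨S', hS', rfl⟩
    · rw [mul_zero]; exact Or.inl rfl
    refine Or.inr ⟨(S ×ˢ S').image fun p => p.1 + p.2, (hS.product hS').image _, ?_⟩
    rw [Finset.sum_image_idem (fun x => add_self_of_one_add_one GermExp.one_add_one x),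
      Finset.sum_mul_sum, ← Finset.sum_product']
    refine Finset.sum_congr rfl fun p _ => ?_
    rw [← Subsemiring.coe_mul, bmono_mul]
    rfl

/-- Every element of `𝔹_ε` is `0` or a finite sum of monomials, inside `𝔹_ε`. [cite: ConnesConsani2016ArithmeticSite, §7.4] -/
theorem exists_bSum' (a : Beps) :
    a = 0 ∨ ∃ S : Finset (ℕ × ℕ), S.Nonempty ∧ a = ∑ p ∈ S, bmono p.1 p.2 := by
  rcases exists_bSum a.2 with h | ⟨S, hS, h⟩
  · exact Or.inl (Subtype.ext h)
  · refine Or.inr ⟨S, hS, Subtype.ext ?_⟩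
    rw [h, AddSubmonoidClass.coe_finsetSum]

/-- `Fr_α` maps `𝔹_ε` into `ℛ_ε(α,α)` (`Fr_α(q) = q^α`, `Fr_α(q^{1+ε}) = q^{(1+ε)α}`).
[cite: ConnesConsani2016ArithmeticSite, Lemma 7.8 (i)] -/
theorem map_frobG_Beps_le {α : ℝ} (hα : 0 < α) : Beps.map (frobG α hα.le) ≤ epsSemiringId α := by
  rw [RingHom.map_closureS, Subsemiring.closure_le]
  rintro _ ⟨g, hg, rfl⟩
  simp only [Set.mem_insert_iff, Set.mem_singleton_iff] at hg
  rcases hg with rfl | rfl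
  · rw [frobG_gaff, mul_one, mul_zero]; exact qα_mem_epsSemiringId α
  · rw [frobG_gaff, mul_one]; exact qαε_mem_epsSemiringId α

/-- `Fr_α(a) ∈ ℛ_ε(α,α)` for `a ∈ 𝔹_ε`. [cite: ConnesConsani2016ArithmeticSite, Lemma 7.8 (i)] -/
theorem frobG_mem_epsSemiringId {α : ℝ} (hα : 0 < α) (a : Beps) :
    frobG α hα.le (a : GermExp) ∈ epsSemiringId α :=
  map_frobG_Beps_le hα ⟨a, a.2, rfl⟩

/-- `ℛ(α) ⊂ ℛ_ε(α,α)` as constant germs (`q^{nα+m} = (q^α)^n q^m`). [cite: ConnesConsani2016ArithmeticSite, Lemma 7.8 (i)] -/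
theorem gconst_mem_epsSemiringId (α : ℝ) (b : frobSemiring α) : gconst (b : 𝕋) ∈ epsSemiringId α := by
  rcases eq_zero_or_eq_rElt b with rfl | ⟨n, m, rfl⟩
  · simp
  · rw [coe_rElt, gconst_texp]
    have h : gaff ((n : ℝ) * α + m) 0 = gaff α 0 ^ n * gaff 1 0 ^ m := by
      rw [gaff_pow, gaff_pow, gaff_mul]; congr 1 <;> ring
    rw [h]
    exact mul_mem (pow_mem (qα_mem_epsSemiringId α) n) (pow_mem (q_mem_epsSemiringId α) m)

/-- **The map `ψ` of Lemma 7.8 (i)**: "`ψ : 𝔹_ε × ℛ(α) → 𝒢`,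
`ψ(q^{(1+ε)i+j}, b) := q^{(1+ε)αi} q^{αj} b`", i.e. "`ψ(a,b) = Fr_α(a) b`", with values in
`ℛ_ε(α,α)`. [cite: ConnesConsani2016ArithmeticSite, Lemma 7.8 (i)] -/
def idPsi (α : ℝ) (hα : 0 < α) (a : Beps) (b : frobSemiring α) : epsSemiringId α :=
  ⟨frobG α hα.le (a : GermExp) * gconst (b : 𝕋),
    mul_mem (frobG_mem_epsSemiringId hα a) (gconst_mem_epsSemiringId α b)⟩

/-- `ψ(a,b) = Fr_α(a) b` in `𝒢`. [cite: ConnesConsani2016ArithmeticSite, Lemma 7.8 (i)] -/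
@[simp] theorem coe_idPsi {α : ℝ} (hα : 0 < α) (a : Beps) (b : frobSemiring α) :
    (idPsi α hα a b : GermExp) = frobG α hα.le (a : GermExp) * gconst (b : 𝕋) := rfl

/-- `Fr_α(r_ε(x)) = ℓ(α)(x)` as germs (`Fr_α(q^n) = q^{αn}`): the source of the balance relation (72).
[cite: ConnesConsani2016ArithmeticSite, Lemma 7.8 (i) eq. (72)] -/
theorem frobG_epsR {α : ℝ} (hα : 0 < α) (x : ℕ̄) :
    frobG α hα.le (epsR x : GermExp) = gconst (frobEll α hα x : 𝕋) := by
  rcases eq_zero_or_eq_nexp x with rfl | ⟨n, rfl⟩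
  · simp
  · rw [coe_epsR, gpowHom_nexp, frobG_gaff, coe_frobEll_nexp, gconst_texp]
    congr 1 <;> ring

/-- "`ψ(q^{(1+ε)i+j}, q^β) = q^{(1+ε)αi} q^{αj} q^β`" — a monomial germ `q^{(αi + αj + β) + εαi}`.
[cite: ConnesConsani2016ArithmeticSite, Lemma 7.8 (i)] -/
theorem coe_idPsi_bmono {α : ℝ} (hα : 0 < α) (i j : ℕ) {β : ℝ} (hβ : β ∈ frobRange α) :
    (idPsi α hα (bmono i j) (rElt α β hβ) : GermExp) = gaff (α * i + α * j + β) (α * i) := by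
  rw [coe_idPsi, coe_bmono, frobG_gaff, coe_rElt, gconst_texp, gaff_mul]
  congr 1 <;> ring

/-- **Connes–Consani 2016, Lemma 7.8 (i)**: "Let `ψ : 𝔹_ε × ℛ(α) → 𝒢` be given by
`ψ(q^{(1+ε)i+j}, b) := q^{(1+ε)αi} q^{αj} b`, `∀ i, j ∈ ℕ`, `b ∈ ℛ(α)`. Then `ψ` is bilinear,
`ψ(aa',bb') = ψ(a,b)ψ(a',b')`, `∀ a, a' ∈ 𝔹_ε`, `b, b' ∈ ℛ(α)` and
`ψ(r_ε(x)a, b) = ψ(a, ℓ(α)(x)b)`, `∀ a ∈ 𝔹_ε`, `b ∈ ℛ(α)`, `x ∈ ℤ_min⁺`." (Proof as printed: "One has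
`ψ(a,b) = Fr_α(a)b` which gives the required properties.") Holds for every real `α > 0`.
[cite: ConnesConsani2016ArithmeticSite, Lemma 7.8 (i)] -/
theorem ConnesConsani2016_lemma_7_8_i {α : ℝ} (hα : 0 < α) :
    IsBalancedBimul idEps (frobCorrespondence α hα) (idPsi α hα) where
  add_left a a' b := Subtype.ext (by simp [add_mul])
  add_right a b b' := Subtype.ext (by simp [mul_add])
  zero_left b := Subtype.ext (by simp)
  zero_right a := Subtype.ext (by simp)
  mul a a' b b' := Subtype.ext (by
    simp only [coe_idPsi, Subsemiring.coe_mul, map_mul]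
    ring)
  one := Subtype.ext (by simp)
  balanced x a b := Subtype.ext (by
    show frobG α hα.le ((epsR x : GermExp) * a) * gconst (b : 𝕋) =
      frobG α hα.le a * gconst ((frobEll α hα x : 𝕋) * b)
    rw [map_mul, frobG_epsR hα, map_mul]
    ring)

/-! ## The calculus of a balanced bilinear multiplicative `φ : 𝔹_ε × ℛ(α) → R` -/

section Calculus78

variable {α : ℝ} {hα : 0 < α} {R : Type*} [CommSemiring R] {φ : Beps → frobSemiring α → R}
  (hφ : IsBalancedBimul idEps (frobCorrespondence α hα) φ)
include hφ

/-- The target has characteristic one: `1 + 1 = 1` (from `1 + 1 = 1` in `𝔹_ε` and bilinearity),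
hence is additively idempotent. [cite: ConnesConsani2016ArithmeticSite, Lemma 7.8 (proof of (ii))] -/
theorem IsBalancedBimul.charOne₈ : (1 : R) + 1 = 1 ∧ ∀ x : R, x + x = x := by
  have h := hφ.add_left 1 1 1
  rw [one_add_one_Beps, hφ.one] at h
  exact ⟨h.symm, add_self_of_one_add_one h.symm⟩

/-- Additively idempotent values. [cite: ConnesConsani2016ArithmeticSite, Lemma 7.8 (proof of (ii))] -/
theorem IsBalancedBimul.add_self₈ (a : Beps) (b : frobSemiring α) : φ a b + φ a b = φ a b :=
  hφ.charOne₈.2 _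

/-- Additivity in the first variable over finite sums. [cite: ConnesConsani2016ArithmeticSite, Lemma 7.8 (ii) ("bilinear")] -/
theorem IsBalancedBimul.sum_left₈ {ι : Type*} (S : Finset ι) (f : ι → Beps) (b : frobSemiring α) :
    φ (∑ i ∈ S, f i) b = ∑ i ∈ S, φ (f i) b := by
  classical
  induction S using Finset.induction_on with
  | empty => simp [hφ.zero_left]
  | insert a S ha ih => rw [Finset.sum_insert ha, Finset.sum_insert ha, hφ.add_left, ih]

/-- Multiplicativity on monomials: `φ(q^{(1+ε)(i+i')}, q^{b+b'}) = φ(q^{(1+ε)i}, q^b) φ(q^{(1+ε)i'}, q^{b'})`.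
[cite: ConnesConsani2016ArithmeticSite, Lemma 7.8 (proof of (ii): "using multiplicativity")] -/
theorem IsBalancedBimul.mul₈ (i i' : ℕ) {b b' : ℝ} (hb : b ∈ frobRange α) (hb' : b' ∈ frobRange α)
    (h : b + b' ∈ frobRange α) :
    φ (bmono (i + i') 0) (rElt α (b + b') h) = φ (bmono i 0) (rElt α b hb) * φ (bmono i' 0) (rElt α b' hb') := by
  rw [← hφ.mul, bmono_mul, Nat.add_zero, rElt_mul hb hb']

/-- "`φ(q^{(1+ε)a}, q^{β})^n = φ(q^{(1+ε)na}, q^{nβ})`". [cite: ConnesConsani2016ArithmeticSite, Lemma 7.8 (proof of (ii), eq. (75))] -/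
theorem IsBalancedBimul.pow₈ (i : ℕ) {b : ℝ} (hb : b ∈ frobRange α) (n : ℕ) (h : (n : ℝ) * b ∈ frobRange α) :
    φ (bmono (n * i) 0) (rElt α (n * b) h) = φ (bmono i 0) (rElt α b hb) ^ n := by
  induction n with
  | zero =>
    rw [pow_zero, Nat.zero_mul, bmono_zero, rElt_congr h (zero_mem_frobRange α) (by simp), rElt_zero, hφ.one]
  | succ n ih =>
    rw [pow_succ, ← ih (nat_mul_mem_frobRange' hb n),
      ← hφ.mul₈ (n * i) i (nat_mul_mem_frobRange' hb n) hb (add_mem_frobRange (nat_mul_mem_frobRange' hb n) hb)]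
    congr 1
    · rw [Nat.succ_mul]
    · exact rElt_congr _ _ (by push_cast; ring)

/-- **The balance relation (72) on monomials**: `φ(q^{(1+ε)i + k}, q^β) = φ(q^{(1+ε)i}, q^{β + αk})`
("Using (72) one has `φ(q^k, q^{nβ₁}) = φ(1, q^{nβ₁ + αk})`").
[cite: ConnesConsani2016ArithmeticSite, Lemma 7.8 (proof of (ii), eq. (72))] -/
theorem IsBalancedBimul.bal₈ (i k : ℕ) {b : ℝ} (hb : b ∈ frobRange α) (h : b + k * α ∈ frobRange α) :
    φ (bmono i k) (rElt α b hb) = φ (bmono i 0) (rElt α (b + k * α) h) := by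
  have e : bmono i k = epsR (nexp k) * bmono i 0 := by rw [← bmono_add_right, Nat.zero_add]
  rw [e, ← frobEll_nexp_mul_rElt hα hb k h]
  exact hφ.balanced (nexp k) (bmono i 0) (rElt α b hb)

/-- Absorption transported from `𝔹_ε`: for `i + j < i' + j'`,
`φ(q^{(1+ε)i+j}, b) + φ(q^{(1+ε)i'+j'}, b) = φ(q^{(1+ε)i+j}, b)`.
[cite: ConnesConsani2016ArithmeticSite, Lemma 7.8 (proof of (ii))] -/
theorem IsBalancedBimul.add_left_lt₈ {i j i' j' : ℕ} (hlt : i + j < i' + j') (b : frobSemiring α) :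
    φ (bmono i j) b + φ (bmono i' j') b = φ (bmono i j) b := by
  rw [← hφ.add_left, bmono_add_of_lt hlt]

/-- For `b ≤ b'`: `φ(a, q^b) + φ(a, q^{b'}) = φ(a, q^b)`. [cite: ConnesConsani2016ArithmeticSite, Lemma 7.8 (proof of (ii))] -/
theorem IsBalancedBimul.add_right_le₈ (a : Beps) {b b' : ℝ} (hb : b ∈ frobRange α)
    (hb' : b' ∈ frobRange α) (hle : b ≤ b') :
    φ a (rElt α b hb) + φ a (rElt α b' hb') = φ a (rElt α b hb) := by
  rw [← hφ.add_right, rElt_add hb hb' (by rwa [min_eq_left hle])]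
  exact congrArg (fun X => φ a X) (rElt_congr _ _ (min_eq_left hle))

end Calculus78

/-! ## The addition rule (74) of the proof of Lemma 7.8 (ii) -/

/-- "We can find `n ∈ ℕ` and `k, k' ∈ ℕ` such that `a₁ < k/n`, `k'/n < a₂`,
`αk/n + β₁ < αk'/n + β₂`" (multiplied through by `n`; for `a₂ = 0` we take `k' = 0`).
[cite: ConnesConsani2016ArithmeticSite, Lemma 7.8 (proof of (ii))] -/
theorem exists_nat_approx₈ {α b₁ b₂ : ℝ} (hα : 0 < α) {a₁ a₂ : ℕ}
    (h : α * a₁ + b₁ < α * a₂ + b₂) :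
    ∃ n k k' : ℕ, 0 < n ∧ n * a₁ < k ∧ (k' < n * a₂ ∨ (a₂ = 0 ∧ k' = 0)) ∧
      α * k + n * b₁ < α * k' + n * b₂ := by
  set g := (α * a₂ + b₂) - (α * a₁ + b₁) with hg
  have hg0 : 0 < g := by rw [hg]; linarith
  obtain ⟨n, hn⟩ := exists_nat_gt (2 * α / g)
  have hn0 : (0 : ℝ) < n := lt_trans (by positivity) hn
  have hn' : 2 * α < n * g := by rwa [div_lt_iff₀ hg0] at hn
  have hn0' : 0 < n := by exact_mod_cast hn0
  rcases Nat.eq_zero_or_pos a₂ with ha₂ | ha₂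
  · refine ⟨n, n * a₁ + 1, 0, hn0', by omega, Or.inr ⟨ha₂, rfl⟩, ?_⟩
    subst ha₂
    push_cast
    rw [hg] at hn'
    simp only [Nat.cast_zero, mul_zero, zero_add] at hn' ⊢
    nlinarith
  · refine ⟨n, n * a₁ + 1, n * a₂ - 1, hn0', by omega, Or.inl (by
      have : 1 ≤ n * a₂ := Nat.one_le_iff_ne_zero.2 (Nat.mul_ne_zero hn0'.ne' ha₂.ne'); omega), ?_⟩
    have h1 : 1 ≤ n * a₂ := Nat.one_le_iff_ne_zero.2 (Nat.mul_ne_zero hn0'.ne' ha₂.ne')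
    push_cast [Nat.cast_sub h1]
    rw [hg] at hn'
    nlinarith

/-- **The addition rule (74)** of the proof of Lemma 7.8 (ii): "Let `a_i ∈ ℕ`, `β_i ∈ ℕ + αℕ` be such
that `αa₁ + β₁ < αa₂ + β₂`. Let us show that
`φ(q^{(1+ε)a₁}, q^{β₁}) + φ(q^{(1+ε)a₂}, q^{β₂}) = φ(q^{(1+ε)a₁}, q^{β₁})`" — for any balanced bilinear
multiplicative `φ : 𝔹_ε × ℛ(α) → R`, `R` multiplicatively cancellative. Proof as printed: `n`-th
powers (75), `a₁ < k/n`, `k'/n < a₂`, the absorptions `q^{(1+ε)na₁} + q^k = q^{(1+ε)na₁}`,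
`q^{(1+ε)na₂} + q^{k'} = q^{k'}` in `𝔹_ε`, and (72).
[cite: ConnesConsani2016ArithmeticSite, Lemma 7.8 (proof of (ii), eq. (74)–(75))] -/
theorem ConnesConsani2016_lemma_7_8_addRule {α : ℝ} (hα : 0 < α) {R : Type*} [CommSemiring R]
    [IsCancelMulZero R] {φ : Beps → frobSemiring α → R}
    (hφ : IsBalancedBimul idEps (frobCorrespondence α hα) φ) {a₁ a₂ : ℕ} {b₁ b₂ : ℝ}
    (hb₁ : b₁ ∈ frobRange α) (hb₂ : b₂ ∈ frobRange α) (hlt : α * a₁ + b₁ < α * a₂ + b₂) :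
    φ (bmono a₁ 0) (rElt α b₁ hb₁) + φ (bmono a₂ 0) (rElt α b₂ hb₂) = φ (bmono a₁ 0) (rElt α b₁ hb₁) := by
  obtain ⟨n, k, k', hn, hk, hk', hlt'⟩ := exists_nat_approx₈ hα hlt
  apply add_eq_left_of_pow_charOne hφ.charOne₈.1 hn.ne'
  rw [← hφ.pow₈ a₁ hb₁ n (nat_mul_mem_frobRange' hb₁ n), ← hφ.pow₈ a₂ hb₂ n (nat_mul_mem_frobRange' hb₂ n)]
  -- the auxiliary values
  have hKb₁ : (n : ℝ) * b₁ + k * α ∈ frobRange α :=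
    add_mem_frobRange (nat_mul_mem_frobRange' hb₁ n) (nat_mul_mem_frobRange α k)
  have hKb₂ : (n : ℝ) * b₂ + k' * α ∈ frobRange α :=
    add_mem_frobRange (nat_mul_mem_frobRange' hb₂ n) (nat_mul_mem_frobRange α k')
  set X := φ (bmono (n * a₁) 0) (rElt α (n * b₁) (nat_mul_mem_frobRange' hb₁ n))
  set Y := φ (bmono (n * a₂) 0) (rElt α (n * b₂) (nat_mul_mem_frobRange' hb₂ n)) with hY
  set K := φ (bmono 0 k) (rElt α (n * b₁) (nat_mul_mem_frobRange' hb₁ n))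
  set K' := φ (bmono 0 k') (rElt α (n * b₂) (nat_mul_mem_frobRange' hb₂ n)) with hK'
  -- `X + K = X` since `na₁ < k` ("in `𝔹_ε`, `q^{(1+ε)na₁} + q^k = q^{(1+ε)na₁}`")
  have hXK : X + K = X := hφ.add_left_lt₈ (by omega) _
  -- `K = φ(1, q^{nβ₁ + αk})`, `K' = φ(1, q^{nβ₂ + αk'})` by (72)
  have hK0 : K = φ (bmono 0 0) (rElt α (n * b₁ + k * α) hKb₁) := hφ.bal₈ 0 k _ hKb₁
  have hK'0 : K' = φ (bmono 0 0) (rElt α (n * b₂ + k' * α) hKb₂) := hφ.bal₈ 0 k' _ hKb₂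
  -- `K + K' = K` since `nβ₁ + αk < nβ₂ + αk'`
  have hKK' : K + K' = K := by
    rw [hK0, hK'0]
    exact hφ.add_right_le₈ _ hKb₁ hKb₂ (by linarith)
  -- `K' + Y = K'` since `k' < na₂` ("`q^{(1+ε)na₂} + q^{k'} = q^{k'}` in `𝔹_ε`"), or trivially if `a₂ = 0 = k'`
  have hK'Y : K' + Y = K' := by
    rcases hk' with hlt₂ | ⟨ha₂, hk'0⟩
    · exact hφ.add_left_lt₈ (by omega) _
    · have hYK : Y = K' := by
        rw [hY, hK']
        subst ha₂; subst hk'0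
        rw [Nat.mul_zero]
      rw [hYK]
      exact hφ.add_self₈ _ _
  calc X + Y = X + K + Y := by rw [hXK]
    _ = X + (K + K' + Y) := by rw [hKK', add_assoc]
    _ = X + (K + (K' + Y)) := by rw [add_assoc K]
    _ = X + K := by rw [hK'Y, hKK']
    _ = X := hXK

/-- `ψ(q^{(1+ε)a}, q^β)` is the monomial germ indexed by `(a, β)`. [cite: ConnesConsani2016ArithmeticSite, Lemma 7.8 (proof of (ii): `U_ε`, `V_ε`, `W_ε`)] -/
theorem coe_idPsi_bmono_eq_epsMono {α : ℝ} (hα : 0 < α) (a : ℕ) {β : ℝ} (hβ : β ∈ frobRange α) :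
    (idPsi α hα (bmono a 0) (rElt α β hβ) : GermExp) = epsMono 1 α (a, β) := by
  rw [coe_idPsi_bmono, epsMono]
  simp only [Nat.cast_zero, mul_zero, add_zero, one_mul]
  congr 1 <;> ring

/-! ## Lemma 7.8 (ii): the universal property of `(ℛ_ε(α,α), ψ)` -/

section Lemma78

variable {α : ℝ} (hα : 0 < α) {R : Type} [CommSemiring R] (φ : Beps → frobSemiring α → R)

open Classical in
/-- The `R`-side monomial `U^a W^β := φ(q^{(1+ε)a}, q^β)` (`U = φ(q^{1+ε},1)`, `W^β = V^bW^c`,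
`β = αb + c`: "The products `V^bW^c` only depend on `β = αb + c`").
[cite: ConnesConsani2016ArithmeticSite, Lemma 7.8 (proof of (ii))] -/
def rMono₈ (t : ℕ × ℝ) : R :=
  if h : t.2 ∈ frobRange α then φ (bmono t.1 0) (rElt α t.2 h) else 0

/-- `rMono₈` on an admissible index. [cite: ConnesConsani2016ArithmeticSite, Lemma 7.8 (proof of (ii))] -/
theorem rMono₈_eq {t : ℕ × ℝ} (h : t.2 ∈ frobRange α) : rMono₈ φ t = φ (bmono t.1 0) (rElt α t.2 h) :=
  dif_pos h

variable (hφ : IsBalancedBimul idEps (frobCorrespondence α hα) φ)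
include hφ

/-- `U^0 W^0 = φ(1,1) = 1`. [cite: ConnesConsani2016ArithmeticSite, Lemma 7.8 (proof of (ii))] -/
theorem rMono₈_zero_zero : rMono₈ φ ((0 : ℕ), (0 : ℝ)) = 1 := by
  rw [rMono₈_eq φ (zero_mem_frobRange α)]
  show φ (bmono 0 0) _ = 1
  rw [bmono_zero, rElt_zero, hφ.one]

/-- Monomials of `R` multiply by adding indices ("if one defines `ρ` on monomials using
multiplicativity"). [cite: ConnesConsani2016ArithmeticSite, Lemma 7.8 (proof of (ii))] -/
theorem rMono₈_add {t t' : ℕ × ℝ} (ht : t.2 ∈ frobRange α) (ht' : t'.2 ∈ frobRange α) :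
    rMono₈ φ (t + t') = rMono₈ φ t * rMono₈ φ t' := by
  rw [rMono₈_eq φ ht, rMono₈_eq φ ht', rMono₈_eq φ (by simpa using add_mem_frobRange ht ht')]
  exact hφ.mul₈ t.1 t'.1 ht ht' (by simpa using add_mem_frobRange ht ht')

variable [IsCancelMulZero R]

/-- **The addition rule for monomials of `R`** ("`αa + αb + c < αa' + αb' + c' ⟹
U^aV^bW^c + U^{a'}V^{b'}W^{c'} = U^aV^bW^c`"). [cite: ConnesConsani2016ArithmeticSite, Lemma 7.8 (proof of (ii))] -/
theorem rMono₈_lt {t t' : ℕ × ℝ} (ht : t.2 ∈ frobRange α) (ht' : t'.2 ∈ frobRange α)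
    (hlt : mval (1 * α) t < mval (1 * α) t') : rMono₈ φ t + rMono₈ φ t' = rMono₈ φ t := by
  rw [rMono₈_eq φ ht, rMono₈_eq φ ht']
  refine ConnesConsani2016_lemma_7_8_addRule hα hφ ht ht' ?_
  simp only [mval, one_mul] at hlt
  linarith [hlt]

/-- **Middle monomials are absorbed** (the role of Lemma 7.5 in the printed proof, "Thus the proof of
(ii) follows from Lemma 7.5"): for three monomials of the same value with `a₁ ≤ a ≤ a₂`,
`M + (M₁ + M₂) = M₁ + M₂`, because `M^{a₂−a₁} = M₁^{a₂−a} M₂^{a−a₁}` exactly.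
[cite: ConnesConsani2016ArithmeticSite, Lemma 7.8 (proof of (ii)) and Lemma 7.5] -/
theorem rMono₈_mid {t t₁ t₂ : ℕ × ℝ} (ht : t.2 ∈ frobRange α) (ht₁ : t₁.2 ∈ frobRange α)
    (ht₂ : t₂.2 ∈ frobRange α) (hv₁ : mval (1 * α) t₁ = mval (1 * α) t)
    (hv₂ : mval (1 * α) t₂ = mval (1 * α) t) (h₁ : t₁.1 ≤ t.1) (h₂ : t.1 ≤ t₂.1) :
    rMono₈ φ t + (rMono₈ φ t₁ + rMono₈ φ t₂) = rMono₈ φ t₁ + rMono₈ φ t₂ := by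
  have h1R : (1 : R) + 1 = 1 := hφ.charOne₈.1
  simp only [mval, one_mul] at hv₁ hv₂
  rcases h₁.eq_or_lt with e₁ | lt₁
  · have : t₁ = t := by
      obtain ⟨a₁, b₁⟩ := t₁
      obtain ⟨a, b⟩ := t
      simp only at e₁ hv₁
      subst e₁
      simp only [Prod.mk.injEq, true_and]
      linarith
    rw [this, ← add_assoc, add_self_of_one_add_one h1R]
  rcases h₂.eq_or_lt with e₂ | lt₂
  · have : t₂ = t := by
      obtain ⟨a₂, b₂⟩ := t₂
      obtain ⟨a, b⟩ := t
      simp only at e₂ hv₂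
      subst e₂
      simp only [Prod.mk.injEq, true_and]
      linarith
    rw [this, add_comm (rMono₈ φ t₁), ← add_assoc, add_self_of_one_add_one h1R]
  -- strict case: convexity
  set p := t.1 - t₁.1 with hp
  set r := t₂.1 - t.1 with hr
  have hp0 : 0 < p := by omega
  have hpr : p + r ≠ 0 := by omega
  refine add_eq_of_pow_eq_mul_pow h1R hpr ?_
  rw [rMono₈_eq φ ht, rMono₈_eq φ ht₁, rMono₈_eq φ ht₂,
    ← hφ.pow₈ t.1 ht (p + r) (nat_mul_mem_frobRange' ht _),
    ← hφ.pow₈ t₁.1 ht₁ r (nat_mul_mem_frobRange' ht₁ _),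
    ← hφ.pow₈ t₂.1 ht₂ p (nat_mul_mem_frobRange' ht₂ _),
    ← hφ.mul₈ (r * t₁.1) (p * t₂.1) (nat_mul_mem_frobRange' ht₁ _) (nat_mul_mem_frobRange' ht₂ _)
      (add_mem_frobRange (nat_mul_mem_frobRange' ht₁ _) (nat_mul_mem_frobRange' ht₂ _))]
  have hpc : ((p : ℕ) : ℝ) = t.1 - t₁.1 := by rw [hp, Nat.cast_sub h₁]
  have hrc : ((r : ℕ) : ℝ) = t₂.1 - t.1 := by rw [hr, Nat.cast_sub h₂]
  have hnat : (p + r) * t.1 = r * t₁.1 + p * t₂.1 := by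
    have : ((((p + r) * t.1 : ℕ)) : ℝ) = ((r * t₁.1 + p * t₂.1 : ℕ) : ℝ) := by
      push_cast; rw [hpc, hrc]; ring
    exact_mod_cast this
  congr 1
  · rw [hnat]
  · exact rElt_congr _ _ (by
      push_cast; rw [hpc, hrc]
      have e1 : t₁.2 = t.2 + (t.1 - t₁.1) * α := by linarith
      have e2 : t₂.2 = t.2 - (t₂.1 - t.1) * α := by linarith
      rw [e1, e2]; ring)

/-- The monomials `U^a W^β ∈ R` obey the rules of the generic skeleton. [cite: ConnesConsani2016ArithmeticSite, Lemma 7.8 (proof of (ii))] -/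
theorem rMono₈_rules : MonoRules 1 α (rMono₈ φ) where
  one_add_one := hφ.charOne₈.1
  lt := fun _ _ ht ht' h => rMono₈_lt hα φ hφ ht ht' h
  mid := fun _ _ _ ht ht₁ ht₂ hv₁ hv₂ h₁ h₂ => rMono₈_mid hα φ hφ ht ht₁ ht₂ hv₁ hv₂ h₁ h₂
  add := fun _ _ ht ht' => rMono₈_add hα φ hφ ht ht'
  zero := rMono₈_zero_zero hα φ hφ

/-- **The homomorphism `ρ : ℛ_ε(α,α) → R`** of Lemma 7.8 (ii). [cite: ConnesConsani2016ArithmeticSite, Lemma 7.8 (ii)] -/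
def rho78Hom : epsSemiringId α →+* R :=
  rhoGHom (rMono₈_rules hα φ hφ) (by rw [one_mul]; exact hα)

/-- `ρ(ψ(q^{(1+ε)i+j}, q^β)) = φ(q^{(1+ε)i+j}, q^β)`. [cite: ConnesConsani2016ArithmeticSite, Lemma 7.8 (ii)] -/
theorem rho78Hom_idPsi_bmono (i j : ℕ) {β : ℝ} (hβ : β ∈ frobRange α) :
    rho78Hom hα φ hφ (idPsi α hα (bmono i j) (rElt α β hβ)) = φ (bmono i j) (rElt α β hβ) := by
  have hβ' : β + j * α ∈ frobRange α := add_mem_frobRange hβ (nat_mul_mem_frobRange α j)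
  have hβ'' : ((i : ℕ), β + j * α).2 ∈ frobRange α := hβ'
  rw [rho78Hom, rhoGHom_epsMono (rMono₈_rules hα φ hφ) _ ((i : ℕ), β + j * α) hβ'' _ (by
      rw [coe_idPsi_bmono, epsMono]
      simp only [one_mul]
      congr 1 <;> ring),
    rMono₈_eq φ hβ'', hφ.bal₈ i j hβ hβ']

/-- **`φ = ρ ∘ ψ`.** [cite: ConnesConsani2016ArithmeticSite, Lemma 7.8 (ii)] -/
theorem rho78Hom_idPsi (a : Beps) (b : frobSemiring α) :
    rho78Hom hα φ hφ (idPsi α hα a b) = φ a b := by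
  rcases eq_zero_or_eq_rElt b with rfl | ⟨n', m', rfl⟩
  · rw [hφ.zero_right, show idPsi α hα a 0 = 0 from Subtype.ext (by simp), map_zero]
  rcases exists_bSum' a with rfl | ⟨S, hS, rfl⟩
  · rw [hφ.zero_left, show idPsi α hα 0 _ = 0 from Subtype.ext (by simp), map_zero]
  rw [(ConnesConsani2016_lemma_7_8_i hα).sum_left₈, map_sum, hφ.sum_left₈]
  exact Finset.sum_congr rfl fun p _ => rho78Hom_idPsi_bmono hα φ hφ p.1 p.2 _

/-- **Lemma 7.8 (ii), existence and uniqueness of `ρ`** ("The equality `φ = ρ ∘ ψ` implies that one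
must have `ρ(U_ε) = U`, `ρ(V_ε) = V`, `ρ(W_ε) = W`, which shows the uniqueness of `ρ`").
[cite: ConnesConsani2016ArithmeticSite, Lemma 7.8 (ii)] -/
theorem existsUnique_rho78 :
    ∃! ρ : epsSemiringId α →+* R, ∀ a b, ρ (idPsi α hα a b) = φ a b := by
  classical
  refine ⟨rho78Hom hα φ hφ, rho78Hom_idPsi hα φ hφ, fun ρ' hρ' => RingHom.ext fun x => ?_⟩
  rcases exists_epsSum x.2 with hx | ⟨S, hS, hSa, hx⟩
  · rw [show x = 0 from Subtype.ext hx, map_zero, map_zero]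
  -- `x = ∑_S ψ(q^{(1+ε)a}, q^β)` in `ℛ_ε(α,α)`
  set f : ℕ × ℝ → epsSemiringId α := fun t =>
    if h : t.2 ∈ frobRange α then idPsi α hα (bmono t.1 0) (rElt α t.2 h) else 0 with hf
  have hxf : x = ∑ t ∈ S, f t := by
    apply Subtype.ext
    rw [hx, AddSubmonoidClass.coe_finsetSum]
    refine Finset.sum_congr rfl fun t ht => ?_
    rw [hf]
    simp only [dif_pos (hSa t ht)]
    rw [coe_idPsi_bmono_eq_epsMono]
  rw [hxf, map_sum, map_sum]
  refine Finset.sum_congr rfl fun t ht => ?_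
  rw [hf]
  simp only [dif_pos (hSa t ht)]
  rw [hρ', rho78Hom_idPsi]

end Lemma78

/-- **Connes–Consani 2016, Lemma 7.8 (ii)**: "Let `R` be a semiring and `φ : 𝔹_ε × ℛ(α) → R` be a
bilinear map such that `φ(aa',bb') = φ(a,b)φ(a',b')`, `∀ a, a' ∈ 𝔹_ε`, `b, b' ∈ ℛ(α)` and
`φ(r_ε(x)a, b) = φ(a, ℓ(α)(x)b)`, `∀ a ∈ 𝔹_ε`, `b ∈ ℛ(α)`, `x ∈ ℤ_min⁺`. Then there exists a unique
homomorphism `ρ : ℛ_ε(α,α) → R` such that `φ = ρ ∘ ψ`." (`R` multiplicatively cancellative, as the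
printed proof uses: "the map `R ∋ x ↦ xⁿ ∈ R` is an injective endomorphism". Printed for
`α ∈ ℚ₊*`; the proof, and this theorem, hold for every real `α > 0`.)
[cite: ConnesConsani2016ArithmeticSite, Lemma 7.8 (ii)] -/
theorem ConnesConsani2016_lemma_7_8_ii {α : ℝ} (hα : 0 < α) {R : Type} [CommSemiring R]
    [IsCancelMulZero R] (φ : Beps → frobSemiring α → R)
    (hφ : IsBalancedBimul idEps (frobCorrespondence α hα) φ) :
    ∃! ρ : epsSemiringId α →+* R, ∀ a b, ρ (idPsi α hα a b) = φ a b :=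
  existsUnique_rho78 hα φ hφ

/-- **Connes–Consani 2016, Lemma 7.8 packaged** ("We first need to determine the reduction of
`𝔹_ε ⊗_{ℤ_min⁺} ℛ(α)`"): `(ℛ_ε(α,α), ψ)` is the reduced semiring of `𝔹_ε ⊗_{ℤ_min⁺} ℛ(α)`, for every
real `α > 0` (printed: "Let `α ∈ ℚ₊*`"). [cite: ConnesConsani2016ArithmeticSite, Lemma 7.8] -/
theorem ConnesConsani2016_lemma_7_8 {α : ℝ} (hα : 0 < α) :
    IsTensorReduction idEps (frobCorrespondence α hα) (epsSemiringId α) (idPsi α hα) :=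
  ⟨inferInstance, ConnesConsani2016_lemma_7_8_i hα, fun _ _ _ φ hφ => existsUnique_rho78 hα φ hφ⟩

/-- **Lemma 7.8 with the printed hypothesis `α ∈ ℚ₊*`.** [cite: ConnesConsani2016ArithmeticSite, Lemma 7.8] -/
theorem ConnesConsani2016_lemma_7_8_rat {α : ℝ} (hα : 0 < α) (_hq : ∃ q : ℚ, (q : ℝ) = α) :
    IsTensorReduction idEps (frobCorrespondence α hα) (epsSemiringId α) (idPsi α hα) :=
  ConnesConsani2016_lemma_7_8 hα

/-! ## The composition `Id_ε ∘ Ψ(α)` is the correspondence (70) -/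

/-- (70) sits inside `ℛ_ε(α,α)`. [cite: ConnesConsani2016ArithmeticSite, §7.4 (end of the proof of Thm. 7.7)] -/
theorem germSemiring_le_epsSemiringId (α : ℝ) : germSemiring α ≤ epsSemiringId α := by
  refine Subsemiring.closure_le.2 ?_
  rintro g hg
  simp only [Set.mem_insert_iff, Set.mem_singleton_iff] at hg
  rcases hg with rfl | rfl
  · exact q_mem_epsSemiringId α
  · exact qαε_mem_epsSemiringId α

/-- **The composition datum for `Id_ε ∘ Ψ(α)`**: by Lemma 7.8 the reduction of `𝔹_ε ⊗ ℛ(α)` is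
`ℛ_ε(α,α)`; "one then takes the left and right actions of `ℤ_min⁺` in the sub-semiring of `𝒢`
generated by the range of `ψ` […]. One gets the sub-semiring of `𝒢` generated by the
`q^{(1+ε)αi + k}` for `i, k ∈ ℕ`, with left action of `q` given by `i ↦ i+1` and right action by
`k ↦ k+1`" — i.e. (70). [cite: ConnesConsani2016ArithmeticSite, §7.4 (end of the proof of Thm. 7.7)] -/
def idFrobCompositionDatum {α : ℝ} (hα : 0 < α) :
    CompositionDatum idEps (frobCorrespondence α hα) (germComp α hα) where
  T := epsSemiringId α
  ψ := idPsi α hα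
  isTensorReduction := ConnesConsani2016_lemma_7_8 hα
  emb := Subsemiring.inclusion (germSemiring_le_epsSemiringId α)
  emb_injective := Subsemiring.inclusion_injective _
  emb_ell x := Subtype.ext (by
    show (gpowHom α α hα x : GermExp) = frobG α hα.le (epsEll x : GermExp) * gconst ((1 : frobSemiring α) : 𝕋)
    rw [Subsemiring.coe_one, map_one, mul_one]
    rcases eq_zero_or_eq_nexp x with rfl | ⟨k, rfl⟩
    · rw [map_zero, map_zero, Subsemiring.coe_zero, map_zero]
    · rw [gpowHom_nexp, coe_epsEll, gpowHom_nexp, frobG_gaff]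
      congr 1 <;> ring)
  emb_r x := Subtype.ext (by
    show (gpowHom 1 0 one_pos x : GermExp) = frobG α hα.le ((1 : Beps) : GermExp) * gconst ((frobR α x : frobSemiring α) : 𝕋)
    rw [Subsemiring.coe_one, map_one, one_mul]
    rcases eq_zero_or_eq_nexp x with rfl | ⟨k, rfl⟩
    · rw [map_zero, map_zero, Subsemiring.coe_zero, map_zero]
    · rw [gpowHom_nexp, coe_frobR_nexp, gconst_texp]
      simp)

/-- **`Id_ε ∘ Ψ(α)` is the correspondence (70)** — "the sub-semiring of `𝒢` generated by the
`q^{(1+ε)αi + k}` for `i, k ∈ ℕ`, with left action of `q` given by `i ↦ i+1` and right action by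
`k ↦ k+1`" — for every real `α > 0`. [cite: ConnesConsani2016ArithmeticSite, §7.4 (end of the proof of Thm. 7.7)] -/
theorem ConnesConsani2016_thm_7_7_idEps_comp {α : ℝ} (hα : 0 < α) :
    IsComposition idEps (frobCorrespondence α hα) (germComp α hα) :=
  ⟨idFrobCompositionDatum hα⟩

/-! ## Compositions are unique up to isomorphism ("Up to canonical isomorphism") -/

namespace CompositionDatum

variable {C₁ C₂ C C' : ReducedCorrespondence}

/-- Two reductions of `R₁ ⊗_{ℤ_min⁺} R₂` are canonically isomorphic, compatibly with `ψ` (the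
universal property both ways). [cite: ConnesConsani2016ArithmeticSite, §7.2 ("Up to canonical isomorphism")] -/
theorem exists_ringEquiv (D : CompositionDatum C₁ C₂ C) (D' : CompositionDatum C₁ C₂ C') :
    ∃ e : D.T ≃+* D'.T, ∀ a b, e (D.ψ a b) = D'.ψ a b := by
  obtain ⟨hT, hψ, hu⟩ := D.isTensorReduction
  obtain ⟨hT', hψ', hu'⟩ := D'.isTensorReduction
  obtain ⟨ρ, hρ, -⟩ := hu D'.T D'.ψ hψ'
  obtain ⟨ρ', hρ', -⟩ := hu' D.T D.ψ hψ
  have h1 : ρ'.comp ρ = RingHom.id D.T := by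
    obtain ⟨σ, -, hσu⟩ := hu D.T D.ψ hψ
    rw [hσu (ρ'.comp ρ) (fun a b => by simp [hρ, hρ']), hσu (RingHom.id _) (fun a b => rfl)]
  have h2 : ρ.comp ρ' = RingHom.id D'.T := by
    obtain ⟨σ, -, hσu⟩ := hu' D'.T D'.ψ hψ'
    rw [hσu (ρ.comp ρ') (fun a b => by simp [hρ, hρ']), hσu (RingHom.id _) (fun a b => rfl)]
  exact ⟨RingEquiv.ofRingHom ρ ρ' h2 h1, hρ⟩

/-- **The composition `C₁ ∘ C₂` is unique up to isomorphism of reduced correspondences**: two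
composition data for `(C₁, C₂)` have isomorphic third terms (the canonical isomorphism of the
reductions restricts to the sub-semirings generated by `ℓ₁ ⊗ Id`, `Id ⊗ r₂`).
[cite: ConnesConsani2016ArithmeticSite, §7.2 ("Up to canonical isomorphism")] -/
theorem iso (D : CompositionDatum C₁ C₂ C) (D' : CompositionDatum C₁ C₂ C') : C.Iso C' := by
  obtain ⟨e, he⟩ := exists_ringEquiv D D'
  let e1 : C.R ≃+* D.emb.rangeS :=
    RingEquiv.ofLeftInverseS (Function.leftInverse_invFun D.emb_injective)
  let e1' : C'.R ≃+* D'.emb.rangeS :=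
    RingEquiv.ofLeftInverseS (Function.leftInverse_invFun D'.emb_injective)
  let e2 : D.emb.rangeS ≃+* D.emb.rangeS.map (e : D.T →+* D'.T) :=
    RingEquiv.subsemiringMap e D.emb.rangeS
  have hmap : D.emb.rangeS.map (e : D.T →+* D'.T) = D'.emb.rangeS := by
    rw [D.rangeS_emb, D'.rangeS_emb, RingHom.map_closureS, Set.image_mul, ← Set.range_comp,
      ← Set.range_comp]
    congr 3
    · funext x; simp [he]
    · funext x; simp [he]
  let e3 := RingEquiv.subsemiringCongr hmap
  let E : C.R ≃+* C'.R := e1.trans (e2.trans (e3.trans e1'.symm))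
  have h1' : ∀ z : D'.emb.rangeS, D'.emb (e1'.symm z) = (z : D'.T) := fun z => by
    obtain ⟨w, hw⟩ := RingHom.mem_rangeS.1 z.2
    rw [RingEquiv.ofLeftInverseS_symm_apply]
    exact Function.invFun_eq ⟨w, hw⟩
  have hE : ∀ y, D'.emb (E y) = e (D.emb y) := fun y => by
    show D'.emb (e1'.symm (e3 (e2 (e1 y)))) = _
    rw [h1']
    rfl
  refine ⟨E, fun x => D'.emb_injective ?_, fun x => D'.emb_injective ?_⟩
  · rw [hE, D.emb_ell, he, D'.emb_ell]
  · rw [hE, D.emb_r, he, D'.emb_r]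

end CompositionDatum

/-- **`C₁ ∘ C₂` is well defined up to isomorphism.** [cite: ConnesConsani2016ArithmeticSite, §7.2 ("Up to canonical isomorphism")] -/
theorem IsComposition.iso {C₁ C₂ C C' : ReducedCorrespondence} (h : IsComposition C₁ C₂ C)
    (h' : IsComposition C₁ C₂ C') : C.Iso C' := by
  obtain ⟨D⟩ := h
  obtain ⟨D'⟩ := h'
  exact D.iso D'

/-- **Connes–Consani 2016, Theorem 7.7, third sentence**: "When `λ, λ'` are irrational and `λλ' ∈ ℚ`,
`Ψ(λ) ∘ Ψ(λ') = Id_ε ∘ Ψ(λλ')` where `Id_ε` is the tangential deformation of the identity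
correspondence." Both compositions are the correspondence (70) with `α = λλ'` (the left side by
Prop. 7.4, `ConnesConsani2016_thm_7_7_resonant`; the right side by Lemma 7.8,
`ConnesConsani2016_thm_7_7_idEps_comp`). [cite: ConnesConsani2016ArithmeticSite, Thm. 7.7] -/
theorem ConnesConsani2016_thm_7_7_third {l l' : ℝ} (hl : 0 < l) (hl' : 0 < l')
    (hirr : Irrational l) (hirr' : Irrational l') (hq : ∃ q : ℚ, (q : ℝ) = l * l') :
    ∃ C : ReducedCorrespondence,
      IsComposition (frobCorrespondence l hl) (frobCorrespondence l' hl') C ∧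
        IsComposition idEps (frobCorrespondence (l * l') (mul_pos hl hl')) C :=
  ⟨germComp (l * l') (mul_pos hl hl'), ConnesConsani2016_thm_7_7_resonant hl hl' hirr hirr' hq,
    ConnesConsani2016_thm_7_7_idEps_comp (mul_pos hl hl')⟩

/-- **Theorem 7.7, third sentence, as an equality of compositions**: for `λ, λ'` irrational with
`λλ' ∈ ℚ`, a reduced correspondence is (isomorphic to) `Ψ(λ) ∘ Ψ(λ')` iff it is (isomorphic to)
`Id_ε ∘ Ψ(λλ')`. [cite: ConnesConsani2016ArithmeticSite, Thm. 7.7] -/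
theorem ConnesConsani2016_thm_7_7_third_iff {l l' : ℝ} (hl : 0 < l) (hl' : 0 < l')
    (hirr : Irrational l) (hirr' : Irrational l') (hq : ∃ q : ℚ, (q : ℝ) = l * l')
    (C : ReducedCorrespondence) :
    IsComposition (frobCorrespondence l hl) (frobCorrespondence l' hl') C ↔
      IsComposition idEps (frobCorrespondence (l * l') (mul_pos hl hl')) C :=
  ⟨fun h => (ConnesConsani2016_thm_7_7_idEps_comp (mul_pos hl hl')).of_iso
      (h.iso (ConnesConsani2016_thm_7_7_resonant hl hl' hirr hirr' hq)),
    fun h => (ConnesConsani2016_thm_7_7_resonant hl hl' hirr hirr' hq).of_iso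
      (h.iso (ConnesConsani2016_thm_7_7_idEps_comp (mul_pos hl hl')))⟩

end Literature.NumberTheory.ConnesConsani
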